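import Summits.KontsevichZagierPeriods.KontsevichZagierPeriods.Theorems.SoloBlindCauchyBeta
import Summits.KontsevichZagierPeriods.KontsevichZagierPeriods.Theorems.SoloBlindBetaReflection
import Summits.KontsevichZagierPeriods.KontsevichZagierPeriods.Theorems.SoloBlindSector
import Summits.KontsevichZagierPeriods.KontsevichZagierPeriods.Theorems.SoloBlindGoldenDilog
import HarnessLib

/-!
# The quintic sector of the Kontsevich–Zagier conjecture

Level `5` is the first level where the Beta periods `B(k/5, l/5)` are not all `ℚ̄`-multiples of
one another and of `π` within a Hodge type: modulo `ℚ̄^×` and the functional equations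
(translation, symmetry, reflection `Γ(s)Γ(1-s) = π/sin πs`) the ten values `B(k/5,l/5)`,
`1 ≤ k ≤ l ≤ 4`, fall into FIVE classes,

* `A = {B(1/5,1/5), B(1/5,3/5)}` (`∼ Γ(1/5)²/Γ(2/5)`), `B = {B(1/5,2/5), B(2/5,2/5)}`
  (`∼ Γ(1/5)Γ(2/5)²/π`) — FIRST KIND (`k + l < 5`),
* `Π = {B(1/5,4/5), B(2/5,3/5)}` (`∼ π`),
* `C = {B(2/5,4/5), B(4/5,4/5)}` (`∼ π Γ(2/5)/Γ(1/5)²`), `D = {B(3/5,3/5), B(3/5,4/5)}`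
  (`∼ π²/(Γ(1/5)Γ(2/5)²)`) — SECOND KIND (`k + l > 5`),

and the conjecture predicts that the two members of each class have proportional CLASSES in the
formal period ring `Q = FormalRep ⧸ (KZ rules)`. For `Π` this is the reflection formula inside the
rules (`betaQ_reflection`, session 8). For `A` and `B` it is the NEW two-dimensional Stokes
mechanism of `SoloBlindCauchyBeta` (`betaQ_fifth_fifth`, `betaQ_twoFifth_twoFifth`): Fubini and
reflection alone only give these proportionalities after multiplication by `x_π`, and `x_π` cannot
be cancelled in `Q` by any known argument.

This file records the resulting picture.

* `xPi_mul_betaQ_four_four`, `betaQ_one_one_mul_betaQ_three_three`: the two SECOND-KIND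
  proportionalities hold in `Q` in CANCELLATION FORM — `x_π·(3β(4/5,4/5) - 2cos(π/5)β(2/5,4/5)) = 0`
  and `β(1/5,1/5)·(2cos(π/5)β(3/5,3/5) - 2β(3/5,4/5)) = 0` (the second one already uses the new
  first-kind relation). Cancelling `x_π`, resp. `β(1/5,1/5)`, is exactly what is missing at
  level 5 (wall W5 of the solo programme): the Stokes mechanism needs an absolutely integrable
  exact `2`-form, and for `k + l > 5` the form `d((z(1-z))^{k/5-1} dz)`-partner is not integrable at
  infinity — these classes are periods of differentials of the second kind.
* `fifthSector`: the sector of `Q` generated by `β(1/5,1/5)`, `β(1/5,2/5)`, `x_π`. It contains the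
  classes of ALL Beta representations `β(k/5 + m, l/5 + n)` of classes `A`, `B`, `Π`
  (`of_betaRep_mem_fifthSector`), their products and `ℚ̄`-multiples. By the sector principle, the
  Kontsevich–Zagier conjecture holds on it as soon as `B(1/5,1/5)`, `B(1/5,2/5)`, `π` are
  algebraically independent over `ℚ̄ ∩ ℝ` (`kz_fifthSector`) — a consequence of the Rohrlich–Lang
  conjecture at level `5` (`trdeg ℚ̄(π, Γ(1/5), Γ(2/5)) = 3`), which is OPEN; known is only
  P. Grinspan, *Measures of simultaneous approximation for quasi-periods of abelian varieties*,
  J. Number Theory 94 (2002): at least two of `π, Γ(1/5), Γ(2/5)` are algebraically independent.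
* `equivalent_betaRep_fifth_golden`: the UNCONDITIONAL instance of the conjecture produced by the
  mechanism — the representations `∫₀¹ (x(1-x))^{-4/5} dx` and `φ ∫₀¹ x^{-4/5}(1-x)^{-2/5} dx`
  (`φ` the golden ratio), which have the same period, are equivalent under the three rules.
-/

noncomputable section

open MeasureTheory Set Real

namespace Summit.KontsevichZagierPeriods.KontsevichZagierPeriods.Theorems

namespace SoloBlind

open Literature.ModelTheory.ExponentialFields (IsSemialgebraic)
open Literature.NumberTheory.Transcendental
open Literature.NumberTheory.Transcendental.KZ

/-! ## Level-5 bookkeeping in `Q` -/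

/-- `β(1/5,4/5) = (1/sin(π/5)) • x_π` (reflection inside the rules). -/
theorem betaQ_one_four : betaQ (1 / 5) (4 / 5) = reflCoeff 1 5 • xPi := by
  have h := betaQ_reflection (p := 1) (n := 5) one_pos (by norm_num)
  norm_num at h
  exact h

/-- `β(2/5,3/5) = (1/sin(2π/5)) • x_π` (reflection inside the rules). -/
theorem betaQ_two_three : betaQ (2 / 5) (3 / 5) = reflCoeff 2 5 • xPi := by
  have h := betaQ_reflection (p := 2) (n := 5) two_pos (by norm_num)
  norm_num at h
  exact h

/-- `2cos(π/5) • β(1/5,3/5) = β(1/5,1/5)` (the Stokes relation, class `A`). -/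
theorem twoCosFifth_smul_betaQ_one_three :
    twoCosFifth 1 • betaQ (1 / 5) (3 / 5) = betaQ (1 / 5) (1 / 5) :=
  betaQ_fifth_fifth.1.symm

/-- `β(2/5,2/5) = 2cos(2π/5) • β(1/5,2/5)` (the Stokes relation, class `B`). -/
theorem betaQ_two_two : betaQ (2 / 5) (2 / 5) = twoCosFifth 2 • betaQ (1 / 5) (2 / 5) := by
  rw [betaQ_twoFifth_twoFifth.1, betaQ_symm (by norm_num) (by norm_num)]

/-- `2cos(π/5) = φ ≠ 0` in `K₀`. -/
theorem twoCosFifth_one_ne_zero : twoCosFifth 1 ≠ 0 := fun h => by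
  have h' := congrArg Subtype.val h
  rw [betaQ_fifth_fifth.2] at h'
  exact goldenRatio_pos.ne' h'

/-- Translation inside a subalgebra: `β(a,b) ∈ A ⇒ β(a,b+1) ∈ A`. -/
theorem betaQ_transl_mem {A : Subalgebra K₀ Q} {a b : ℚ} (ha : 0 < a) (hb : 0 < b)
    (h : betaQ a b ∈ A) : betaQ a (b + 1) ∈ A := by
  have hab : ((a + b : ℚ) : K₀) ≠ 0 := by exact_mod_cast (add_pos ha hb).ne'
  have e : betaQ a (b + 1) = ((a + b : ℚ) : K₀)⁻¹ • ((b : K₀) • betaQ a b) := by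
    rw [← betaQ_transl ha hb, inv_smul_smul₀ hab]
  rw [e]
  exact A.smul_mem (A.smul_mem h _) _

/-- Translation closure: `β(a,b) ∈ A ⇒ β(a+m, b+n) ∈ A` for all `m n : ℕ`. -/
theorem betaQ_shift_mem {A : Subalgebra K₀ Q} {a b : ℚ} (ha : 0 < a) (hb : 0 < b)
    (h : betaQ a b ∈ A) (m n : ℕ) : betaQ (a + m) (b + n) ∈ A := by
  have hm : betaQ (a + m) b ∈ A := by
    induction m with
    | zero => simpa using h
    | succ k ih =>
      have hak : 0 < a + k := by positivity
      rw [betaQ_symm (by positivity) hb, Nat.cast_succ, ← add_assoc]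
      rw [betaQ_symm hak hb] at ih
      exact betaQ_transl_mem hb hak ih
  induction n with
  | zero => simpa using hm
  | succ k ih =>
    rw [Nat.cast_succ, ← add_assoc]
    exact betaQ_transl_mem (by positivity) (by positivity) ih

/-! ## The second-kind proportionalities in cancellation form (wall W5) -/

/-- `1 / sin(πp/5) ≠ 0` in `K₀` for `p = 1, 2`. -/
theorem reflCoeff_fifth_ne_zero {p : ℕ} (hp : 0 < p) (hp5 : p < 5) : reflCoeff p 5 ≠ 0 := fun h => by
  have h' := congrArg Subtype.val h
  rw [coe_reflCoeff, ZeroMemClass.coe_zero] at h'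
  exact inv_ne_zero (sin_pos_of_lt hp hp5).ne' h'

/-- The scalar identity behind class `C`: `(3/5)/sin(2π/5) · 2cos(π/5) = (1/5)/sin(π/5) · 3`. -/
theorem fifth_scalar_identity :
    ((3 / 5 : ℚ) : K₀) * reflCoeff 2 5 * twoCosFifth 1 = ((1 / 5 : ℚ) : K₀) * reflCoeff 1 5 * 3 := by
  apply Subtype.ext
  simp only [MulMemClass.coe_mul, coe_reflCoeff, twoCosFifth_val, SubfieldClass.coe_ratCast]
  rw [show ((3 : K₀) : ℝ) = 3 from rfl]
  push_cast
  have h5 : 0 < Real.sin (Real.pi / 5) :=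
    Real.sin_pos_of_pos_of_lt_pi (by positivity) (by linarith [Real.pi_pos])
  have hc : 0 < Real.cos (Real.pi / 5) :=
    Real.cos_pos_of_mem_Ioo ⟨by linarith [Real.pi_pos], by linarith [Real.pi_pos]⟩
  rw [show Real.pi * (2 / 5 : ℝ) = 2 * (Real.pi / 5) by ring,
    show Real.pi * (1 / 5 : ℝ) = Real.pi / 5 by ring, Real.sin_two_mul]
  field_simp

/-- **Class `C` in cancellation form**: `x_π · (3 β(4/5,4/5)) = x_π · (2cos(π/5) β(2/5,4/5))` in
`Q` — Dirichlet's formula `β(8/5,2/5)β(4/5,4/5) = β(4/5,2/5)β(4/5,6/5)`, two translations and two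
reflections. The conjecture predicts `3β(4/5,4/5) = 2cos(π/5)β(2/5,4/5)` itself; cancelling `x_π`
is open. -/
theorem xPi_mul_betaQ_four_four :
    xPi * ((3 : K₀) • betaQ (4 / 5) (4 / 5)) = xPi * (twoCosFifth 1 • betaQ (2 / 5) (4 / 5)) := by
  have hD := betaQ_dirichlet (a := 4 / 5) (b := 4 / 5) (c := 2 / 5) (by norm_num) (by norm_num)
    (by norm_num)
  rw [show (4 / 5 + 4 / 5 : ℚ) = 8 / 5 by norm_num, show (4 / 5 + 2 / 5 : ℚ) = 6 / 5 by norm_num]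
    at hD
  have hT1 := betaQ_transl (a := 2 / 5) (b := 3 / 5) (by norm_num) (by norm_num)
  rw [show (2 / 5 + 3 / 5 : ℚ) = 1 by norm_num, Rat.cast_one, one_smul,
    show (3 / 5 + 1 : ℚ) = 8 / 5 by norm_num] at hT1
  have hT2 := betaQ_transl (a := 4 / 5) (b := 1 / 5) (by norm_num) (by norm_num)
  rw [show (4 / 5 + 1 / 5 : ℚ) = 1 by norm_num, Rat.cast_one, one_smul,
    show (1 / 5 + 1 : ℚ) = 6 / 5 by norm_num] at hT2
  have e1 : betaQ (8 / 5) (2 / 5) = (((3 / 5 : ℚ) : K₀) * reflCoeff 2 5) • xPi := by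
    rw [betaQ_symm (by norm_num) (by norm_num), hT1, betaQ_two_three, smul_smul]
  have e2 : betaQ (4 / 5) (6 / 5) = (((1 / 5 : ℚ) : K₀) * reflCoeff 1 5) • xPi := by
    rw [hT2, betaQ_symm (by norm_num) (by norm_num), betaQ_one_four, smul_smul]
  rw [e1, e2, smul_mul_assoc, mul_smul_comm, mul_comm (betaQ (4 / 5) (2 / 5)) xPi,
    betaQ_symm (a := 4 / 5) (b := 2 / 5) (by norm_num) (by norm_num)] at hD
  -- `hD : κ₁ • (x_π * β(4/5,4/5)) = κ₂ • (x_π * β(2/5,4/5))`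
  have hκ1 : ((3 / 5 : ℚ) : K₀) * reflCoeff 2 5 ≠ 0 :=
    mul_ne_zero (by exact_mod_cast (show (3 / 5 : ℚ) ≠ 0 by norm_num))
      (reflCoeff_fifth_ne_zero two_pos (by norm_num))
  rw [mul_smul_comm, mul_smul_comm]
  refine smul_right_injective Q hκ1 ?_
  dsimp only
  rw [smul_smul, smul_smul, mul_comm _ (3 : K₀), mul_smul, hD, smul_smul, fifth_scalar_identity,
    mul_comm _ (3 : K₀)]

/-- **Class `D` in cancellation form**: `β(1/5,1/5) · (2cos(π/5) β(3/5,3/5)) =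
β(1/5,1/5) · (2 β(3/5,4/5))` in `Q` — Dirichlet's formula
`β(6/5,1/5)β(3/5,3/5) = β(3/5,1/5)β(3/5,4/5)`, one translation and the NEW first-kind relation
`2cos(π/5)β(1/5,3/5) = β(1/5,1/5)`. Cancelling `β(1/5,1/5)` is open. -/
theorem betaQ_one_one_mul_betaQ_three_three :
    betaQ (1 / 5) (1 / 5) * (twoCosFifth 1 • betaQ (3 / 5) (3 / 5)) =
      betaQ (1 / 5) (1 / 5) * ((2 : K₀) • betaQ (3 / 5) (4 / 5)) := by
  have hD := betaQ_dirichlet (a := 3 / 5) (b := 3 / 5) (c := 1 / 5) (by norm_num) (by norm_num)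
    (by norm_num)
  rw [show (3 / 5 + 3 / 5 : ℚ) = 6 / 5 by norm_num, show (3 / 5 + 1 / 5 : ℚ) = 4 / 5 by norm_num,
    betaQ_symm (a := 6 / 5) (b := 1 / 5) (by norm_num) (by norm_num),
    betaQ_symm (a := 3 / 5) (b := 1 / 5) (by norm_num) (by norm_num)] at hD
  -- `hD : β(1/5,6/5) * β(3/5,3/5) = β(1/5,3/5) * β(3/5,4/5)`
  have hT := betaQ_transl (a := 1 / 5) (b := 1 / 5) (by norm_num) (by norm_num)
  rw [show (1 / 5 + 1 / 5 : ℚ) = 2 / 5 by norm_num, show (1 / 5 + 1 : ℚ) = 6 / 5 by norm_num] at hT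
  -- `hT : (2/5) • β(1/5,6/5) = (1/5) • β(1/5,1/5)`
  have h25 : ((2 / 5 : ℚ) : K₀) = ((1 / 5 : ℚ) : K₀) * 2 := by
    rw [show (2 : K₀) = ((2 : ℚ) : K₀) by norm_cast, ← Rat.cast_mul]; norm_num
  have h15 : ((1 / 5 : ℚ) : K₀) ≠ 0 := by exact_mod_cast (show (1 / 5 : ℚ) ≠ 0 by norm_num)
  refine smul_right_injective Q h15 ?_
  dsimp only
  calc ((1 / 5 : ℚ) : K₀) • (betaQ (1 / 5) (1 / 5) * (twoCosFifth 1 • betaQ (3 / 5) (3 / 5)))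
      = twoCosFifth 1 • ((((1 / 5 : ℚ) : K₀) • betaQ (1 / 5) (1 / 5)) * betaQ (3 / 5) (3 / 5)) := by
        rw [mul_smul_comm, smul_comm, ← smul_mul_assoc]
    _ = (twoCosFifth 1 * ((2 / 5 : ℚ) : K₀)) • (betaQ (1 / 5) (3 / 5) * betaQ (3 / 5) (4 / 5)) := by
        rw [← hT, smul_mul_assoc, smul_smul, hD]
    _ = ((2 / 5 : ℚ) : K₀) • ((twoCosFifth 1 • betaQ (1 / 5) (3 / 5)) * betaQ (3 / 5) (4 / 5)) := by
        rw [smul_mul_assoc, smul_smul, mul_comm (twoCosFifth 1)]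
    _ = ((1 / 5 : ℚ) : K₀) • (betaQ (1 / 5) (1 / 5) * ((2 : K₀) • betaQ (3 / 5) (4 / 5))) := by
        rw [twoCosFifth_smul_betaQ_one_three, mul_smul_comm (2 : K₀) (betaQ (1 / 5) (1 / 5)), smul_smul,
          ← h25]

/-! ## The first-kind quintic sector -/

/-- The generators `β(1/5,1/5)`, `β(1/5,2/5)`, `x_π` of the quintic sector. -/
def fifthGen : Fin 3 → Q := ![betaQ (1 / 5) (1 / 5), betaQ (1 / 5) (2 / 5), xPi]

/-- The periods of the generators: `B(1/5,1/5)`, `B(1/5,2/5)`, `π`. -/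
theorem evalQ_fifthGen : (fun i => evalQ (fifthGen i)) =
    ![Real.Gamma (1 / 5) * Real.Gamma (1 / 5) / Real.Gamma (2 / 5),
      Real.Gamma (1 / 5) * Real.Gamma (2 / 5) / Real.Gamma (3 / 5), Real.pi] := by
  have e0 : evalQ (betaQ (1 / 5) (1 / 5)) =
      Real.Gamma (1 / 5) * Real.Gamma (1 / 5) / Real.Gamma (2 / 5) := by
    rw [evalQ_betaQ (by norm_num) (by norm_num)]; norm_num
  have e1 : evalQ (betaQ (1 / 5) (2 / 5)) =
      Real.Gamma (1 / 5) * Real.Gamma (2 / 5) / Real.Gamma (3 / 5) := by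
    rw [evalQ_betaQ (by norm_num) (by norm_num)]; norm_num
  funext i
  fin_cases i
  · exact e0
  · exact e1
  · exact evalQ_xPi

/-- **The quintic sector**: formal `ℤ`-combinations of integral representations whose class is a
`K₀`-polynomial in `β(1/5,1/5)`, `β(1/5,2/5)`, `x_π`. -/
def fifthSector : NonUnitalSubring FormalRep := sector (range fifthGen)

/-- The ten ordered pairs `(k/5, l/5)` of the classes `A`, `B`, `Π`. -/
def fifthPairs : Finset (ℚ × ℚ) :=
  {(1 / 5, 1 / 5), (1 / 5, 3 / 5), (3 / 5, 1 / 5), (1 / 5, 2 / 5), (2 / 5, 1 / 5), (2 / 5, 2 / 5),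
    (1 / 5, 4 / 5), (4 / 5, 1 / 5), (2 / 5, 3 / 5), (3 / 5, 2 / 5)}

/-- Every Beta class of classes `A`, `B`, `Π` is a `K₀`-polynomial (indeed a multiple of a
generator) in `β(1/5,1/5)`, `β(1/5,2/5)`, `x_π` — by the Stokes relations, symmetry and
reflection. -/
theorem betaQ_mem_adjoin_fifthGen {a b : ℚ} (h : (a, b) ∈ fifthPairs) :
    betaQ a b ∈ Algebra.adjoin K₀ (range fifthGen) := by
  set A := Algebra.adjoin K₀ (range fifthGen) with hA
  have g0 : betaQ (1 / 5) (1 / 5) ∈ A := Algebra.subset_adjoin ⟨0, rfl⟩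
  have g1 : betaQ (1 / 5) (2 / 5) ∈ A := Algebra.subset_adjoin ⟨1, rfl⟩
  have g2 : xPi ∈ A := Algebra.subset_adjoin ⟨2, rfl⟩
  have g13 : betaQ (1 / 5) (3 / 5) ∈ A := by
    have e : betaQ (1 / 5) (3 / 5) = (twoCosFifth 1)⁻¹ • betaQ (1 / 5) (1 / 5) := by
      rw [← twoCosFifth_smul_betaQ_one_three, inv_smul_smul₀ twoCosFifth_one_ne_zero]
    rw [e]
    exact A.smul_mem g0 _
  have g22 : betaQ (2 / 5) (2 / 5) ∈ A := by rw [betaQ_two_two]; exact A.smul_mem g1 _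
  have g14 : betaQ (1 / 5) (4 / 5) ∈ A := by rw [betaQ_one_four]; exact A.smul_mem g2 _
  have g23 : betaQ (2 / 5) (3 / 5) ∈ A := by rw [betaQ_two_three]; exact A.smul_mem g2 _
  simp only [fifthPairs, Finset.mem_insert, Finset.mem_singleton, Prod.mk.injEq] at h
  rcases h with h | h | h | h | h | h | h | h | h | h <;> obtain ⟨rfl, rfl⟩ := h
  · exact g0
  · exact g13
  · rw [betaQ_symm (by norm_num) (by norm_num)]; exact g13
  · exact g1
  · rw [betaQ_symm (by norm_num) (by norm_num)]; exact g1
  · exact g22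
  · exact g14
  · rw [betaQ_symm (by norm_num) (by norm_num)]; exact g14
  · exact g23
  · rw [betaQ_symm (by norm_num) (by norm_num)]; exact g23

/-- The pairs in `fifthPairs` have positive entries. -/
theorem pos_of_mem_fifthPairs {a b : ℚ} (h : (a, b) ∈ fifthPairs) : 0 < a ∧ 0 < b := by
  simp only [fifthPairs, Finset.mem_insert, Finset.mem_singleton, Prod.mk.injEq] at h
  rcases h with h | h | h | h | h | h | h | h | h | h <;> obtain ⟨rfl, rfl⟩ := h <;> norm_num

/-- **All first-kind and `π`-type quintic Beta representations lie in the quintic sector**: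
`β(k/5 + m, l/5 + n) ∈ fifthSector` for `(k/5, l/5) ∈ fifthPairs`, `m n : ℕ`. -/
theorem of_betaRep_mem_fifthSector {a b : ℚ} (h : (a, b) ∈ fifthPairs) (m n : ℕ)
    (ha : 0 < a + m) (hb : 0 < b + n) : of (betaRep (a + m) (b + n) ha hb) ∈ fifthSector := by
  rw [fifthSector, mem_sector, ← betaQ_eq]
  exact betaQ_shift_mem (pos_of_mem_fifthPairs h).1 (pos_of_mem_fifthPairs h).2
    (betaQ_mem_adjoin_fifthGen h) m n

/-- The `π`-sector is contained in the quintic sector. -/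
theorem piSector_le_fifthSector : piSector ≤ fifthSector := by
  rw [piSector_eq_sector, fifthSector]
  exact sector_mono (by rintro _ rfl; exact ⟨2, rfl⟩)

/-- **The Kontsevich–Zagier conjecture on the quintic sector, conditionally.** If `B(1/5,1/5)`,
`B(1/5,2/5)` and `π` are algebraically independent over `ℚ̄ ∩ ℝ` (a consequence of the
Rohrlich–Lang conjecture at level `5`; open), then any two integral representations in the quintic
sector with the same period are equivalent under the three rules. -/
theorem kz_fifthSector (h : AlgebraicIndependent K₀ fun i => evalQ (fifthGen i)) {n m : ℕ}
    (r : IntegralRep n) (r' : IntegralRep m) (hr : of r ∈ fifthSector)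
    (hr' : of r' ∈ fifthSector) (hv : r.value = r'.value) : Equivalent r r' :=
  kz_sector h r r' hr hr' hv

/-- Sharpness: the hypothesis of `kz_fifthSector` holds iff the three generators are formally
independent in `Q` and the conjecture holds on the quintic sector. -/
theorem kz_fifthSector_iff :
    (AlgebraicIndependent K₀ fun i => evalQ (fifthGen i)) ↔ AlgebraicIndependent K₀ fifthGen ∧
      ∀ z ∈ fifthSector, eval z = 0 → z ∈ relations :=
  sector_kernel_iff fifthGen

/-- **An unconditional instance of the conjecture at level 5.** The one-dimensional
representations `∫_{(0,1)} x^{-4/5}(1-x)^{-4/5} dx` and `φ · ∫_{(0,1)} x^{-4/5}(1-x)^{-2/5} dx`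
(`φ = (1+√5)/2`), whose periods `B(1/5,1/5) = φ B(1/5,3/5)` agree, are equivalent under the
Kontsevich–Zagier rules — by a genuinely two-dimensional detour (Fubini, Newton–Leibniz in two
fibre directions, two changes of variables). -/
theorem equivalent_betaRep_fifth_golden :
    Equivalent (betaRep (1 / 5) (1 / 5) (by norm_num) (by norm_num))
      ((betaRep (1 / 5) (3 / 5) (by norm_num) (by norm_num)).constMul goldenRatio
        isAlgebraic_goldenRatio) := by
  have h := betaQ_fifth_fifth.1
  rw [betaQ_eq (show (0:ℚ) < 1 / 5 by norm_num) (show (0:ℚ) < 1 / 5 by norm_num),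
    betaQ_eq (show (0:ℚ) < 1 / 5 by norm_num) (show (0:ℚ) < 3 / 5 by norm_num)] at h
  have hc : twoCosFifth 1 = ⟨goldenRatio, mem_K₀_iff.mpr isAlgebraic_goldenRatio⟩ :=
    Subtype.ext betaQ_fifth_fifth.2
  rw [hc, ← mkQ_constMul, mkQ_eq_mkQ_iff] at h
  exact h

/-- The periods agree: `B(1/5,1/5) = φ · B(1/5,3/5)` as real numbers `Γ(1/5)²/Γ(2/5) = φ·Γ(1/5)Γ(3/5)/Γ(4/5)`,
read off from the relation in `Q` by the period map (classically: two reflection formulas). -/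
theorem Gamma_fifth_golden :
    Real.Gamma (1 / 5) * Real.Gamma (1 / 5) / Real.Gamma (2 / 5) =
      goldenRatio * (Real.Gamma (1 / 5) * Real.Gamma (3 / 5) / Real.Gamma (4 / 5)) := by
  have h := congrArg evalQ betaQ_fifth_fifth.1
  rw [evalQ_smul, betaQ_fifth_fifth.2, evalQ_betaQ (by norm_num) (by norm_num),
    evalQ_betaQ (by norm_num) (by norm_num)] at h
  norm_num at h
  exact h

end SoloBlind

end Summit.KontsevichZagierPeriods.KontsevichZagierPeriods.Theorems
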